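import Summits.QuantumFields.YangMills.Theorems.BalabanUVNodesN07TowerGaugeCoverLift
import Literature.MathematicalPhysics.QuantumFieldTheory.Balaban1983to89.B8Eq131CubesRec
import HarnessLib

/-!
# N07 [B11] (= [15] = [Balaban1985Variational]) Sect. F — **THE R7 DOOR's `v = localGaugeZ …` (CLAMPED FIELD, UNGUARDED AVERAGES) IS THE GUARDED TOWER GAUGE ON THE FINE WINDOW,
# HENCE `(h̄·w)(π(x + c_k·𝟙))` THERE** — the window ∕ clamping ∕ guard bookkeeping that FILE-2 (`…N07TowerGaugeCoverLift`, p723776) left out (g10's knit item (3c), second half)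

Cell `pub-ymgap`, width seat `pub-ymgap-dag-n07-w3` g11 (N05-REC R7 → THE KNIT).  `--kind proof --supports stmt-QuantumFields-20542 --as helper` (K1⁷; count-neutral).  THEOREMS ONLY.
[6] = [Balaban1985RegularSpaces]; [3] = [Balaban1985Averaging]; [15] = [Balaban1985Variational]; [I] = [Balaban1987RG1].

WHY.  The door's member row (v) reads S3's gauge through `c.vfix V = localGaugeZ L tLo tHi V k ctr` = dag-n05-d's `towerGaugeZ` of the CLAMPED field `clampCfg (tlo k) (thi k) V` built on
the UNGUARDED record averages `avgIterZ`; FILE-2 identified the tower gauge of the GUARDED averages `avgIterZG` of the UNCLAMPED lift with the chart's `h̄·w`.  The two agree on the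
fine window `[tlo k, thi k]` because (a) the tower gauge at a point of the depth-`n` cube reads the level-`(k−n)` averages only on the depth-`n` cube (the (1.15) recursion descends through
`fl` ∕ block centres, which stay in the cubes: n05-d `fl_mem` + `smul_mem_succ`; `axialFn_congr`), (b) the clamped field's averages are the unclamped field's on those cubes (n05-d
`agree_level` with `clampCfg_agree`), (c) the unguarded averages are the guarded ones there as long as every intermediate guarded average is inside the (0.4) guard on the windows
(`bavgZG_eq_bavgZ_of_small` one level at a time inside n05-d's locality `bavgZ_congr` ∕ `pair_mem`) — the run's small-field class on `□̃` (displayed here as `hs`, in torus currency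
through g9 `smallZ_avgIterZG_coverLift_iff_small`).

WHAT IS PROVED (kernel; axioms standard).
§1 `smul_mem_succ` (block centres of the depth-`n` cube lie in the depth-`(n+1)` cube), `iterate_fl_mem` (`fl^[n]` of a point of the depth-`n` cube lies in `[lo, hi]`).
§2 ★ `avgIterZ_agree_avgIterZG_of_smallZ` (generic `𝔸`: unguarded = guarded `j`-fold averages on the depth-`(k−j)` cube under the guard `hs`), `avgIterZ_clampCfg_agree` (clamped = unclamped there).
§3 ★ `tgZ_congr` (generic group: towers agreeing level `k−n` on the depth-`n` cube have the same `tgZ` on the cubes, top centre in `[lo, hi]`).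
§4 ★★ `localGaugeZ_eq_tgZ_avgIterZG_of_smallZ` (generic `𝔸`): `localGaugeZ L lo hi V k y x = tgZ L (avgIterZG L δ V) k y k x` on the fine window under `hs`.
§5 ★★★ `localGaugeZ_coverLiftShift_eq_blockLift_axialGaugeAt_mul` (torus, `SU(N)`): for `k ≤ m + K`, `U` with `M^i U`, `i < k`, inside the (0.4) guard over the label windows, a RESIDUAL `w`
   with `M^i(U^w)` radial-axial below `k`, a centre `ctr ∈ [lo, hi]` of a NON-WRAPPING label window and `x ∈ [tlo k, thi k]`:
   `localGaugeZ L lo hi V k ctr x = ιSU (blockLift k (axialGaugeAt (M^k(U^w)) lo hi ctr) (π(x + c_k·𝟙)) · w (π(x + c_k·𝟙)))`, `V x μ = ιSU (U ⟨π(x + c_k·𝟙), μ⟩)` — §4 + FILE-2;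
   ★★★ `localGaugeZ_coverLiftShift_eq_of_mem_tcubeZ` — the same in the door's letters (`x ∈ tcubeZ L a M ρ k`, window `[tLo a ρ, tHi a M ρ]`, root `ctr a M`, no-wrap `M + 4ρ ≤ sitesPerDir k`).
HONEST FRAMING: count-neutral kernel bookkeeping by name (dag-n05-d `B8Ineq130Rec`∕`B8Eq115GaugeFixingRec`, `BlockAveragingZd`, this lineage's g9∕FILE-2); the guard `hs` is a displayed
HYPOTHESIS (the run's small-field class; not derived here); RADIAL contours (the door as landed) — the road word on the row-9 currency (plan A3⁵: ρ2 ∕ ρ3) is NOT prejudged; nothing of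
[6]∕[3]∕[15]∕[I] analysis asserted; `HThm4RecDbar` ∕ `HThm4Rec` UNDISCHARGED (caveat (C-S3-1)); N05 ∕ N07 NOT discharged; counts unmoved (typed 28∕28 · discharged 8∕27); one finite 𝕋⁴
programme at fixed ε — R4 closes the conditional finite-𝕋⁴ rung `BalabanLadder.UV` only; the YM mass gap (Clay) is NOT proved by any of this; nothing continuum ∕ ℝ⁴ ∕ OS.
No `def`, no `instance`, no `notation`, no `sorry`.

References: [6] (1.14)–(1.15) p. 78, p. 98–99; [3] p. 24 (locality of (42)), (43) p. 24; [15] (147) p. 301, (181) p. 307; [I] (0.1) p. 251, (0.3)–(0.4) pp. 252–253, (0.21) p. 256.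
-/

set_option autoImplicit false

noncomputable section

open scoped Matrix.Norms.L2Operator

namespace Summit.QuantumFields.YangMills.BalabanUVNodes.N07TowerGaugeCoverLiftWindow

open Literature.MathematicalPhysics.QuantumFieldTheory.Balaban1983to89
open Literature.MathematicalPhysics.QuantumFieldTheory.Balaban1983to89.Node00
open Summit.QuantumFields.Balaban3D.Carriers
open Summit.QuantumFields.YangMills.BalabanUVNodes.N07RadialHolCoverLift
open Summit.QuantumFields.YangMills.BalabanUVNodes.N07TowerGaugeCoverLift
open B15Eq112TorusCover (cover)
open B14DomainGeom (Pt)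
open B7Prop1Explicit (hol treeWord axialFn e)
open B7Prop1Local (InBox AgreeOn clampCfg clampCfg_agree)
open B7Prop2Explicit (rescale rescale_apply)
open BlockAveragingZd (offZ ctrShift bavgZ bavgZG avgIterZ avgIterZG SmallZ bavgZG_eq_bavgZ_of_small avgIterZ_succ avgIterZG_succ)
open BlockAveraging (blockAvg)
open ExpMeanLog (expMeanLogSU deltaSU)
open B8Ineq130 (axialFn_congr inBox_of_le)
open B8Ineq130Rec (fl tlo thi tlo_zero thi_zero fl_mem pair_mem bavgZ_congr agree_level)
open B8Eq115GaugeFixingRec (tgZ tgZ_zero tgZ_succ localGaugeZ towerGaugeZ)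
open B8Eq119TwistedAxialRec (flmZ iterate_fl_eq_flmZ)
open B12GaugeOrbits021 (IsResidual)
open B15Eq177GaugeInvariance (blockLift)
open T4AxialGaugeRooted (axialGaugeAt)

/-! ## §1  Window arithmetic on the centred tower -/

section Window

variable {d : ℕ}

/-- The centre `L•z` of the block over a label `z` of the depth-`n` cube lies in the depth-`(n+1)` cube (`tlo (n+1) = L•tlo n − s𝟙`, `thi (n+1) = L•thi n + s𝟙`).
[cite: Balaban1985RegularSpaces, p.98 (bookkeeping); Balaban1987RG1, (0.3) p.252] -/
theorem smul_mem_succ (L : ℕ) {lo hi : B7Prop1Explicit.Site d} {n : ℕ} {z : B7Prop1Explicit.Site d} (hz : tlo L lo n ≤ z) (hz' : z ≤ thi L hi n) :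
    tlo L lo (n + 1) ≤ (L : ℤ) • z ∧ (L : ℤ) • z ≤ thi L hi (n + 1) := by
  have hL0 : (0 : ℤ) ≤ L := by positivity
  have hs0 : (0 : ℤ) ≤ (((L - 1) / 2 : ℕ) : ℤ) := by positivity
  constructor
  · intro i
    rw [B8Ineq130Rec.tlo_succ_apply, Pi.smul_apply, smul_eq_mul]
    nlinarith [hz i, mul_le_mul_of_nonneg_left (hz i) hL0]
  · intro i
    rw [B8Ineq130Rec.thi_succ_apply, Pi.smul_apply, smul_eq_mul]
    nlinarith [hz' i, mul_le_mul_of_nonneg_left (hz' i) hL0]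

/-- Iterating `fl_mem`: the `n`-fold centred block label of a point of the depth-`n` cube lies in the top cube `[lo, hi]`. [cite: Balaban1987RG1, (0.3) p.252 (bookkeeping)] -/
theorem iterate_fl_mem {L s : ℕ} (hL : L = 2 * s + 1) {lo hi : B7Prop1Explicit.Site d} :
    ∀ (n : ℕ) {x : B7Prop1Explicit.Site d}, tlo L lo n ≤ x → x ≤ thi L hi n → lo ≤ (fl L)^[n] x ∧ (fl L)^[n] x ≤ hi
  | 0, x, hx, hx' => by simpa using And.intro hx hx'
  | n + 1, x, hx, hx' => by
    rw [Function.iterate_succ_apply]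
    have h := fl_mem hL hx hx'
    exact iterate_fl_mem hL n h.1 h.2

end Window

/-! ## §2  Guarded = unguarded record averages on the tower's windows, under the guard -/

section Guard

variable {d : ℕ} {𝔸 : Type*} [NormedRing 𝔸] [NormedAlgebra ℂ 𝔸] [CompleteSpace 𝔸]

/-- ★ **ON THE WINDOWS OF THE CENTRED TOWER THE UNGUARDED RECORD AVERAGES ARE THE GUARDED ONES, UNDER THE GUARD**: if at every level `i < k` the guarded `i`-fold average is inside the
(0.4) guard at every label bond of the depth-`(k−i−1)` cube (read at the centre base point `L•q`), then for every `j ≤ k` the two `j`-fold editions agree on the bonds of the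
depth-`(k−j)` cube — dag-n05-d's locality `bavgZ_congr` ∕ `pair_mem` one level at a time + `bavgZG_eq_bavgZ_of_small`. [cite: Balaban1987RG1, (0.4) p.253; Balaban1985Averaging, p.24 (locality of (42))] -/
theorem avgIterZ_agree_avgIterZG_of_smallZ {L s : ℕ} (hL : L = 2 * s + 1) {lo hi : B7Prop1Explicit.Site d} {k : ℕ} (V : B7Prop1Explicit.Site d → Fin d → 𝔸ˣ) (δ : ℝ)
    (hs : ∀ i, i < k → ∀ (q : B7Prop1Explicit.Site d) (κ : Fin d), tlo L lo (k - (i + 1)) ≤ q → q + e κ ≤ thi L hi (k - (i + 1)) →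
      SmallZ L δ (avgIterZG L δ V i) ((L : ℤ) • q) κ) :
    ∀ j, j ≤ k → AgreeOn (tlo L lo (k - j)) (thi L hi (k - j)) (avgIterZ L V j) (avgIterZG L δ V j)
  | 0, _ => fun _ _ _ _ => rfl
  | j + 1, hj => by
    intro q κ hq hqκ
    rw [avgIterZ_succ, avgIterZG_succ, rescale_apply, rescale_apply]
    have hq1 : tlo L lo (k - (j + 1)) ≤ q := fun i => (hq i).1
    have hq2 : q + e κ ≤ thi L hi (k - (j + 1)) := fun i => (hqκ i).2
    rw [bavgZG_eq_bavgZ_of_small L (hs j (by omega) q κ hq1 hq2)]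
    have ih := avgIterZ_agree_avgIterZG_of_smallZ hL V δ hs j (by omega)
    rw [show k - j = k - (j + 1) + 1 by omega] at ih
    have hpm := pair_mem (L := L) (lo := lo) (hi := hi) (z := q) (κ := κ) hq1 hq2
    exact bavgZ_congr hL ih _ κ hpm.1 hpm.2

/-- The CLAMPED field's unguarded averages are the unclamped field's, on the windows (dag-n05-d `agree_level` with `clampCfg_agree`). [cite: Balaban1985RegularSpaces, p.99 («by the construction of U₀″»); Balaban1987RG1, (0.4) p.253] -/
theorem avgIterZ_clampCfg_agree {L s : ℕ} (hL : L = 2 * s + 1) {lo hi : B7Prop1Explicit.Site d} {k : ℕ} (V : B7Prop1Explicit.Site d → Fin d → 𝔸ˣ) {j : ℕ} (hj : j ≤ k) :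
    AgreeOn (tlo L lo (k - j)) (thi L hi (k - j)) (avgIterZ L (clampCfg (tlo L lo k) (thi L hi k) V) j) (avgIterZ L V j) := by
  refine agree_level hL j (k - j) ?_
  rw [Nat.sub_add_cancel hj]
  exact clampCfg_agree V

end Guard

/-! ## §3  The tower gauge reads its averages only on the windows -/

section Congr

variable {d : ℕ} {G : Type*} [Group G]

/-- ★ **LOCALITY OF THE TOWER GAUGE**: two towers of level fields agreeing, level `k − n` on the depth-`n` cube, for all `n ≤ k`, have the same `tgZ` on the cubes (top centre `y ∈ [lo, hi]`):
the recursion `u_j(x) = u_{j+1}(fl x)·Ūʲ(Γ_{L•fl x, x})` only reads `Ūʲ` inside the depth-`(k−j)` cube (`axialFn_congr`, `fl_mem`, `smul_mem_succ`). [cite: Balaban1985RegularSpaces, (1.15) p.78, p.98; Balaban1987RG1, (0.3) p.252] -/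
theorem tgZ_congr {L s : ℕ} (hL : L = 2 * s + 1) {lo hi : B7Prop1Explicit.Site d} {k : ℕ} {W W' : ℕ → B7Prop1Explicit.Site d → Fin d → G}
    (h : ∀ n, n ≤ k → AgreeOn (tlo L lo n) (thi L hi n) (W (k - n)) (W' (k - n))) {y : B7Prop1Explicit.Site d} (hy : lo ≤ y) (hy' : y ≤ hi) :
    ∀ n, n ≤ k → ∀ x : B7Prop1Explicit.Site d, tlo L lo n ≤ x → x ≤ thi L hi n → tgZ L W k y n x = tgZ L W' k y n x
  | 0, _, x, hx, hx' => by
    rw [tgZ_zero, tgZ_zero]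
    have h0 := h 0 (Nat.zero_le _)
    rw [Nat.sub_zero, tlo_zero, thi_zero] at h0
    rw [tlo_zero] at hx; rw [thi_zero] at hx'
    exact axialFn_congr h0 y x (inBox_of_le hy hy') (inBox_of_le hx hx')
  | n + 1, hn, x, hx, hx' => by
    rw [tgZ_succ, tgZ_succ]
    have hf := fl_mem hL hx hx'
    have hc := smul_mem_succ L hf.1 hf.2
    rw [tgZ_congr hL h hy hy' n (Nat.le_of_succ_le hn) (fl L x) hf.1 hf.2,
      axialFn_congr (h (n + 1) hn) _ x (inBox_of_le hc.1 hc.2) (inBox_of_le hx hx')]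

end Congr

/-! ## §4  The door's `localGaugeZ` IS the guarded tower gauge on the window -/

section Local

variable {d : ℕ} {𝔸 : Type*} [NormedRing 𝔸] [NormedAlgebra ℂ 𝔸] [CompleteSpace 𝔸]

/-- ★★ **`localGaugeZ L lo hi V k y x = tgZ L (avgIterZG L δ V) k y k x` ON THE FINE WINDOW UNDER THE GUARD**: the door's gauge `v` (tower gauge of the CLAMPED field with UNGUARDED
averages, dag-n05-d `localGaugeZ`) is, at every point `x` of the finest cube `[tlo k, thi k]`, the tower gauge of the GUARDED record averages of the unclamped field (top centre
`y ∈ [lo, hi]`), provided the guarded averages are inside the (0.4) guard on the windows (`hs`). [cite: Balaban1985RegularSpaces, p.98, (1.15) p.78; Balaban1987RG1, (0.3)–(0.4) pp.252–253] -/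
theorem localGaugeZ_eq_tgZ_avgIterZG_of_smallZ {L s : ℕ} (hL : L = 2 * s + 1) {lo hi : B7Prop1Explicit.Site d} {k : ℕ} (V : B7Prop1Explicit.Site d → Fin d → 𝔸ˣ) (δ : ℝ)
    (hs : ∀ i, i < k → ∀ (q : B7Prop1Explicit.Site d) (κ : Fin d), tlo L lo (k - (i + 1)) ≤ q → q + e κ ≤ thi L hi (k - (i + 1)) →
      SmallZ L δ (avgIterZG L δ V i) ((L : ℤ) • q) κ)
    {y : B7Prop1Explicit.Site d} (hy : lo ≤ y) (hy' : y ≤ hi) {x : B7Prop1Explicit.Site d} (hx : tlo L lo k ≤ x) (hx' : x ≤ thi L hi k) :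
    localGaugeZ L lo hi V k y x = tgZ L (avgIterZG L δ V) k y k x := by
  refine tgZ_congr hL (fun n hn => ?_) hy hy' k le_rfl x hx hx'
  have h1 := avgIterZ_clampCfg_agree hL (lo := lo) (hi := hi) V (Nat.sub_le k n)
  have h2 := avgIterZ_agree_avgIterZG_of_smallZ hL V δ hs (k - n) (Nat.sub_le k n)
  rw [Nat.sub_sub_self hn] at h1 h2
  exact fun q κ hq hqκ => (h1 q κ hq hqκ).trans (h2 q κ hq hqκ)

end Local

/-! ## §5  At the objects of the knit: the door's `v` through the cover -/

section Torus

variable {P : Params} (N : ℕ) [NeZero N]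

/-- ★★★ **THE DOOR's `v` IS THE CHART's `h̄·w` ON THE FINE WINDOW**: for `k ≤ m + K`, a torus field `U` whose record averages `M^i U`, `i < k`, are inside the (0.4) guard on the bonds
over the label windows (`hs`, the run's small-field class on `□̃`), a RESIDUAL `w` with `M^i(U^w)` radial-axial below `k`, a top centre `ctr ∈ [lo, hi]` of a NON-WRAPPING label
window, and every point `x` of the finest cube `[tlo k, thi k]`:
`localGaugeZ L lo hi V k ctr x = ιSU (blockLift k (axialGaugeAt (M^k(U^w)) lo hi ctr) (π(x + c_k·𝟙)) · w (π(x + c_k·𝟙)))`, `V x μ = ιSU (U ⟨π(x + c_k·𝟙), μ⟩)` — §4 + FILE-2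
`towerGaugeZ_avgIterZG_coverLift_eq_blockLift_axialGaugeAt_mul` + g9 `smallZ_avgIterZG_coverLift_iff_small` + `iterate_fl_mem`.
[cite: Balaban1985RegularSpaces, p.98, (1.14)–(1.15) p.78; Balaban1985Variational, (147) p.301, (181) p.307; Balaban1987RG1, (0.3)–(0.4) pp.252–253, (0.21) p.256] -/
theorem localGaugeZ_coverLiftShift_eq_blockLift_axialGaugeAt_mul {k : ℕ} (hk : k ≤ P.m + P.K) (U : GaugeField P 0 (SU N)) (w : GaugeTransf P 0 (SU N))
    (hres : IsResidual k w)
    (hax : ∀ i, i < k → AxialGauge (radialContourData P i (SU N)) (Averaging.iter (fun _ => blockAvg expMeanLogSU) i (GaugeField.gaugeAct w U)))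
    {lo hi ctr : Pt P.d} (hctr : lo ≤ ctr) (hctr' : ctr ≤ hi) (hN : ∀ κ, hi κ - lo κ < P.sitesPerDir k)
    (hs : ∀ i, i < k → ∀ (q : Pt P.d) (κ : Fin P.d), tlo P.L lo (k - (i + 1)) ≤ q → q + e κ ≤ thi P.L hi (k - (i + 1)) →
      BlockAveraging.Small expMeanLogSU (Averaging.iter (fun _ => blockAvg expMeanLogSU) i U)
        ⟨coverAt P (i + 1) (q + fun _ => ((ctrShift P.L (k - (i + 1)) : ℕ) : ℤ)), κ⟩)
    {x : Pt P.d} (hx : tlo P.L lo k ≤ x) (hx' : x ≤ thi P.L hi k) :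
    letI : CStarAlgebra (MatA N) := {}
    localGaugeZ P.L lo hi (fun x μ => ιSU N (U ⟨cover P (x + fun _ => ((ctrShift P.L k : ℕ) : ℤ)), μ⟩)) k ctr x =
      ιSU N (blockLift k (axialGaugeAt (Averaging.iter (fun _ => blockAvg expMeanLogSU) k (GaugeField.gaugeAct w U)) lo hi ctr)
          (cover P (x + fun _ => ((ctrShift P.L k : ℕ) : ℤ))) * w (cover P (x + fun _ => ((ctrShift P.L k : ℕ) : ℤ)))) := by
  letI : CStarAlgebra (MatA N) := {}
  obtain ⟨s, hs'⟩ := P.hL.1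
  have hL : P.L = 2 * s + 1 := by omega
  have hsm : ∀ i, i < k → ∀ (q : Pt P.d) (κ : Fin P.d), tlo P.L lo (k - (i + 1)) ≤ q → q + e κ ≤ thi P.L hi (k - (i + 1)) →
      SmallZ P.L (deltaSU (Fin N)) (avgIterZG P.L (deltaSU (Fin N)) (fun x μ => ιSU N (U ⟨cover P (x + fun _ => ((ctrShift P.L k : ℕ) : ℤ)), μ⟩)) i)
        ((P.L : ℤ) • q) κ :=
    fun i hi q κ hq hqκ => (smallZ_avgIterZG_coverLift_iff_small N hk U hi q κ).mpr (hs i hi q κ hq hqκ)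
  have hwin := iterate_fl_mem hL k hx hx'
  rw [iterate_fl_eq_flmZ P.hL.1] at hwin
  rw [localGaugeZ_eq_tgZ_avgIterZG_of_smallZ hL _ (deltaSU (Fin N)) hsm hctr hctr' hx hx',
    towerGaugeZ_avgIterZG_coverLift_eq_blockLift_axialGaugeAt_mul N hk U w hres hax ctr hN hwin.1 hwin.2]

/-- ★★★ **THE SAME IN THE DOOR's LETTERS** (`□̃ᶻ = tcubeZ L a M ρ k`, window `[tLo a ρ, tHi a M ρ]`, root `ctr a M` — the arguments of `Node00.CubeB8DZ.vfix` at `c = propCubePZ …`: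
`c.a = cornerP`, `c.M = sideP`, `c.ρ = ρ`): for `x ∈ □̃ᶻ`, `1 ≤ M`, and the no-wrap `M + 4ρ ≤ sitesPerDir k` (the knit's guard `Mc + 44 + 6ρ ≤ sitesPerDir k` with `sideP ≤ Mc + 44 + 2ρ`),
`localGaugeZ L (tLo a ρ) (tHi a M ρ) V k (ctr a M) x = ιSU (h̄(π(x + c_k·𝟙)) · w(π(x + c_k·𝟙)))`, `h = axialGaugeAt (M^k(U^w)) (tLo a ρ) (tHi a M ρ) (ctr a M)`.
[cite: Balaban1985RegularSpaces, p.98 («□̃», its centre `y`), (1.15) p.78; Balaban1985Variational, (144) p.300, (147) p.301, (181) p.307; Balaban1987RG1, (0.3)–(0.4) pp.252–253] -/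
theorem localGaugeZ_coverLiftShift_eq_of_mem_tcubeZ {k : ℕ} (hk : k ≤ P.m + P.K) (U : GaugeField P 0 (SU N)) (w : GaugeTransf P 0 (SU N))
    (hres : IsResidual k w)
    (hax : ∀ i, i < k → AxialGauge (radialContourData P i (SU N)) (Averaging.iter (fun _ => blockAvg expMeanLogSU) i (GaugeField.gaugeAct w U)))
    (a : Pt P.d) {M ρ : ℕ} (hM : 1 ≤ M) (hwrap : M + 4 * ρ ≤ P.sitesPerDir k)
    (hs : ∀ i, i < k → ∀ (q : Pt P.d) (κ : Fin P.d), tlo P.L (B8Eq131Cubes.tLo a ρ) (k - (i + 1)) ≤ q → q + e κ ≤ thi P.L (B8Eq131Cubes.tHi a M ρ) (k - (i + 1)) →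
      BlockAveraging.Small expMeanLogSU (Averaging.iter (fun _ => blockAvg expMeanLogSU) i U)
        ⟨coverAt P (i + 1) (q + fun _ => ((ctrShift P.L (k - (i + 1)) : ℕ) : ℤ)), κ⟩)
    {x : Pt P.d} (hx : x ∈ B8Eq131CubesRec.tcubeZ P.L a M ρ k) :
    letI : CStarAlgebra (MatA N) := {}
    localGaugeZ P.L (B8Eq131Cubes.tLo a ρ) (B8Eq131Cubes.tHi a M ρ) (fun x μ => ιSU N (U ⟨cover P (x + fun _ => ((ctrShift P.L k : ℕ) : ℤ)), μ⟩)) k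
        (B8Eq131Cubes.ctr a M) x =
      ιSU N (blockLift k (axialGaugeAt (Averaging.iter (fun _ => blockAvg expMeanLogSU) k (GaugeField.gaugeAct w U))
            (B8Eq131Cubes.tLo a ρ) (B8Eq131Cubes.tHi a M ρ) (B8Eq131Cubes.ctr a M))
          (cover P (x + fun _ => ((ctrShift P.L k : ℕ) : ℤ))) * w (cover P (x + fun _ => ((ctrShift P.L k : ℕ) : ℤ)))) := by
  have hc := B8Eq131Cubes.ctr_mem (a := a) (ρ := ρ) hM
  refine localGaugeZ_coverLiftShift_eq_blockLift_axialGaugeAt_mul N hk U w hres hax hc.1 hc.2.1 (fun κ => ?_) hs (fun i => (hx i).1) (fun i => (hx i).2)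
  have h : ((M + 4 * ρ : ℕ) : ℤ) ≤ P.sitesPerDir k := by exact_mod_cast hwrap
  simp only [B8Eq131Cubes.tLo, B8Eq131Cubes.tHi]
  push_cast at h ⊢
  omega

end Torus

end Summit.QuantumFields.YangMills.BalabanUVNodes.N07TowerGaugeCoverLiftWindow

end

/-! ## Axiom audit (gate whitelist: `propext`, `Classical.choice`, `Quot.sound`) -/
#print axioms Summit.QuantumFields.YangMills.BalabanUVNodes.N07TowerGaugeCoverLiftWindow.localGaugeZ_coverLiftShift_eq_blockLift_axialGaugeAt_mul
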